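import Summits.BirchSwinnertonDyer.BirchSwinnertonDyer.Theorems.CyclotomicUntwistCompanionShapeLaw
import HarnessLib

/-!
# The O6 sub-partition (A)/(B)/(C) of `Additive/WildThreeResidualShapeLaws.lean` with its binders
# discharged by name (route `CyclotomicUntwist` seat `bsd-line-cycu-p2` g5; O6 lane V10; THEOREMS ONLY)

`Additive/WildThreeResidualShapeLaws.lean` §3–§4 proves the kernel consequences of the O6 anatomy under
explicit binders: `hF` (non-vanishing of the stable-line sign), `hlaw : CompanionShapeLawThree`,
`hloc : ∀ W, LocIrr W 3 ↔ ShapeIrrThree W`. All three are now tree theorems —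
`valuation_stableLineSignThree` (x11b3-p8), `companionShapeLawThree_holds` (this seat, p618264),
`O5.locIrr_three_iff_forall_not_isRoot` (harvest-2 E89) — so the consequences hold by name:

* `wildResidue_exhaustive'` — every elliptic `W/ℚ` is in class (A), (B) or (C);
* (`hloc` is `Additive.locIrr_iff_shapeIrrThree_forall`, `Additive/WildThreeResidualShapeLocIrr.lean`);
* `no_semistable_companion_of_residueC'` — an ET-side (class (C)) wild curve with irreducible
  `ρ̄_{W,3}` has NO semistable companion `O5.IsCompanionAtThree W G`;
* `seedType_of_residue` — a semistable companion of an (A) curve is supersingular at `3`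
  (`3 ∣ c₃(G)`), of a (B) curve ordinary or multiplicative (`3 ∤ c₃(G)`).

HONEST FRAMING: bookkeeping corollaries; `NonGenericTransportShapeThree` / `FouquetWanPointClaimShape`
stay hypothesis SHAPES; nothing about any particular curve is asserted; no mark moves; BSD is not proved
for any curve. References: [Serre1972] §1.11; [FouquetWan2021] Thm. 1.8.
-/

set_option linter.dupNamespace false

noncomputable section

open scoped Classical

namespace Summit.BirchSwinnertonDyer.BirchSwinnertonDyer.Theorems.CompanionShape

open Polynomial WeierstrassCurve Literature.NumberTheory.EllipticCurves
  Literature.NumberTheory.EllipticCurves.Rank1Residual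
  Summit.BirchSwinnertonDyer.Rank1Residual.Additive Summit.BirchSwinnertonDyer.Rank1Residual

/-- **(A) ∨ (B) ∨ (C) is everything**, binder-free (the stable-line sign never vanishes,
`valuation_stableLineSignThree`). [cite: Serre1972, §1.11] -/
theorem wildResidue_exhaustive' (W : WeierstrassCurve ℚ) [W.IsElliptic] :
    WildResidueA W ∨ WildResidueB W ∨ WildResidueC W :=
  wildResidue_exhaustive W fun _ hx ↦ (valuation_stableLineSignThree W hx).1

/-- **Class (C) is the irreducible core, unconditionally**: an ET-side wild curve with irreducible
`ρ̄_{W,3}` has no semistable companion at `3`. [cite: Serre1972, §1.11 Prop. 11–12] -/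
theorem no_semistable_companion_of_residueC'
    (W G : WeierstrassCurve ℚ) [W.IsElliptic] [W.IsGloballyMinimal] [G.IsElliptic] [G.IsGloballyMinimal]
    (hO6 : ClassO6 W 3) (hirr : W.HasIrreducibleModPGaloisRep 3) (hC : WildResidueC W) :
    ¬ O5.IsCompanionAtThree W G :=
  no_semistable_companion_of_residueC companionShapeLawThree_holds W G hO6 hirr hC

/-- **Seed types, unconditionally**: a semistable companion of an (A) curve is supersingular at `3`,
of a (B) curve ordinary or multiplicative at `3`. [cite: Serre1972, §1.11 Prop. 11–12] -/
theorem seedType_of_residue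
    (W G : WeierstrassCurve ℚ) [W.IsElliptic] [W.IsGloballyMinimal] [G.IsElliptic] [G.IsGloballyMinimal]
    (hO6 : ClassO6 W 3) (hirr : W.HasIrreducibleModPGaloisRep 3) (hcomp : O5.IsCompanionAtThree W G) :
    (WildResidueA W → ((G.LFunction 3 : ℤ) : ZMod 3) = 0) ∧
      (WildResidueB W → ((G.LFunction 3 : ℤ) : ZMod 3) ≠ 0) :=
  seedType_of_companionShapeLaw companionShapeLawThree_holds W G hO6 hirr hcomp

end Summit.BirchSwinnertonDyer.BirchSwinnertonDyer.Theorems.CompanionShape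

end
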